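/-
Copyright (c) 2026 The decomp-a2c cell. All rights reserved.
Released under Apache 2.0 license as described in the file LICENSE.
-/
import Summits.AtomisticToContinuum.Crystallization.Theorems.ChartedZeroExcessLayeredLatticeLiouvilleWQ

/-!
# ChartedZeroExcessLayeredLatticeLiouville — part WR «FluxDrift»: the column flux of a truncated-harmonic field drifts along the central column at
  a ϱ-FREE linear rate, `‖colFlux T φ γ₀ m − colFlux T φ γ₀ α₀‖ ≤ 216·K·(η_g + 2η_h)·|m − α₀|`
  (decomp-a2c-lens-2, g58; helper of stmt-AtomisticToContinuum-26636, leaf (PC) `ProfileComparisonAt`; the FluxDrift step of memo NODE-g58d §3–4)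

The divergence identity of part WC (`colFlux_sub_colFlux_of_residual`) and its majorant (WD `norm_colFluxDiv_le`) express one step of the column
flux at a harmonic site as truncated bonds applied to PARALLELOGRAM differences (mixed second differences `D₃D_iφ`) and in-plane SECOND
differences (`D_iD_jφ`).  On the half ball both are bounded POINTWISE (part WM `norm_gap_halfBall`, `norm_hessian_halfBall`), so:

* `norm_pgram_le_of_sup`, `sum_wt_pgram_le` — the parallelogram term under a sup `G` of the mixed second differences on the `⌊ϱ/c⌋`-neighbourhood:
  `Σ_Y idxWt·‖pgram‖ ≤ 108·G` (paths of `≤ 2N²` bonds, moment `Σ idxWt·N² ≤ 54`); the sup form of WE's mean-square `sum_wt_pgram_sq_le`;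
* ★ `norm_colFlux_step_le` — one step: `‖colFlux T ψ γ m − colFlux T ψ γ (m − 1)‖ ≤ 216·K·(G + 2G₂)` (`G₂` = sup of the in-plane second
  differences on the `3⌊ϱ/c⌋`-box of the layer, WE `sum_wt_sdiff2_le`);
* `dist_site_le`, ★ `norm_colFlux_step_halfBall` — the step on the central column of `idxBall x₀ n` for `|k − α₀| + 3⌊ϱ/c⌋₊ ≤ n/2`:
  `≤ 216·K·(η_g + 2η_h)`, `η_g = √(864·gradConst·E/(n²N))`, `η_h = √(864·(6912·(54K/κ₀)·lipConst)·E/(n²N))` — all `ϱ`-free;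
* ★★ `norm_colFlux_drift_le` — telescoped: `‖colFlux T φ x₀.1 m − colFlux T φ x₀.1 x₀.2‖ ≤ 216·K·(η_g + 2η_h)·|m − x₀.2|` whenever `T` contains
  the layers within `|m − α₀| + ⌊ϱ/c⌋₊` of `α₀`.

With part WQ (slope mismatch `≤ 216·K·δ₁·(|m − α₀| + 1)`) this completes the bound `‖h(m)‖ ≤ C_h·(|m − α₀| + 1)·ε₁` of the flux drift of
NODE-g58d §3 with `C_h` `ϱ`-free (critic row 1007 (ii)/(iii)); what remains of (PC) is the FarBand correction and the window bootstrap.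
-/

namespace Summit.AtomisticToContinuum.Crystallization.Theorems.ChartedZeroExcessLayeredLatticeLiouville

open Summit.AtomisticToContinuum.Crystallization.Theorems.ChartedPlanarOrderRigidityDoor (E3)
open Finset
open scoped InnerProductSpace RealInnerProductSpace BigOperators

noncomputable section FluxDrift

variable {c : ℝ} {a b : E3} {w : ℤ → E3}

/-! ### WR.1  The parallelogram term under a sup of the mixed second differences -/

/-- the parallelogram difference over a near offset `(d, t)`, `N(d, t) ≤ r`, under a sup `G` of `‖D₃D₁ψ‖`, `‖D₃D₂ψ‖` on the `r`-neighbourhood of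
`(γ, m)`: `‖pgram ψ (γ, m) (γ + d, m + t)‖ ≤ 2·N(d,t)²·G` (WE `norm_pgram_le'`: `≤ |t|·(|d 0| + |d 1|)` path bonds). [this file, g58] -/
theorem norm_pgram_le_of_sup (ψ : Cell 2 → ℤ → E3) (γ d : Cell 2) (m t : ℤ) {r : ℕ} (hv : idxNorm (d, t) ≤ r) {G : ℝ} (hG0 : 0 ≤ G)
    (hG : ∀ u : Cell 2 × ℤ, idxNorm u ≤ r →
      ‖latDiff idxAxis₃ (latDiff idxAxis₁ ψ) (γ + u.1) (m + u.2)‖ ≤ G ∧ ‖latDiff idxAxis₃ (latDiff idxAxis₂ ψ) (γ + u.1) (m + u.2)‖ ≤ G) :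
    ‖pgram ψ (γ, m) (γ + d, m + t)‖ ≤ 2 * (idxNorm (d, t) : ℝ) ^ 2 * G := by
  have hN0 : (((d 0).natAbs : ℕ) : ℝ) ≤ idxNorm (d, t) := by exact_mod_cast natAbs_fst_le_idxNorm (d, t) 0
  have hN1 : (((d 1).natAbs : ℕ) : ℝ) ≤ idxNorm (d, t) := by exact_mod_cast natAbs_fst_le_idxNorm (d, t) 1
  have hNt : ((t.natAbs : ℕ) : ℝ) ≤ idxNorm (d, t) := by exact_mod_cast natAbs_snd_le_idxNorm (d, t)
  have hterm : ∀ j ∈ range t.natAbs,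
      ((∑ i ∈ range (d 0).natAbs,
          ‖latDiff idxAxis₃ (latDiff idxAxis₁ ψ) (γ + (min (d 0) 0 + ((i : ℕ) : ℤ)) • (Pi.single 0 1 : Cell 2)) (m + (min t 0 + ((j : ℕ) : ℤ)))‖) +
        ∑ i ∈ range (d 1).natAbs,
          ‖latDiff idxAxis₃ (latDiff idxAxis₂ ψ) (γ + (d 0 • (Pi.single 0 1 : Cell 2) + (min (d 1) 0 + ((i : ℕ) : ℤ)) • (Pi.single 1 1 : Cell 2)))
            (m + (min t 0 + ((j : ℕ) : ℤ)))‖) ≤ ((((d 0).natAbs : ℕ) : ℝ) + (((d 1).natAbs : ℕ) : ℝ)) * G := by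
    intro j hj
    have h1 : ∑ i ∈ range (d 0).natAbs,
        ‖latDiff idxAxis₃ (latDiff idxAxis₁ ψ) (γ + (min (d 0) 0 + ((i : ℕ) : ℤ)) • (Pi.single 0 1 : Cell 2)) (m + (min t 0 + ((j : ℕ) : ℤ)))‖ ≤
        ∑ _i ∈ range (d 0).natAbs, G :=
      sum_le_sum fun i hi => (hG ((min (d 0) 0 + ((i : ℕ) : ℤ)) • (Pi.single 0 1 : Cell 2), min t 0 + ((j : ℕ) : ℤ))
        (idxNorm_path₁_le d t hv hi hj)).1
    have h2 : ∑ i ∈ range (d 1).natAbs,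
        ‖latDiff idxAxis₃ (latDiff idxAxis₂ ψ) (γ + (d 0 • (Pi.single 0 1 : Cell 2) + (min (d 1) 0 + ((i : ℕ) : ℤ)) • (Pi.single 1 1 : Cell 2)))
          (m + (min t 0 + ((j : ℕ) : ℤ)))‖ ≤ ∑ _i ∈ range (d 1).natAbs, G :=
      sum_le_sum fun i hi => (hG (d 0 • (Pi.single 0 1 : Cell 2) + (min (d 1) 0 + ((i : ℕ) : ℤ)) • (Pi.single 1 1 : Cell 2), min t 0 + ((j : ℕ) : ℤ))
        (idxNorm_path₂_le d t hv hi hj)).2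
    rw [sum_const, card_range, nsmul_eq_mul] at h1 h2
    linarith
  refine (norm_pgram_le' ψ γ d m t).trans ((sum_le_sum hterm).trans ?_)
  rw [sum_const, card_range, nsmul_eq_mul]
  have hG' : 0 ≤ ((((d 0).natAbs : ℕ) : ℝ) + (((d 1).natAbs : ℕ) : ℝ)) * G := by positivity
  calc ((t.natAbs : ℕ) : ℝ) * (((((d 0).natAbs : ℕ) : ℝ) + (((d 1).natAbs : ℕ) : ℝ)) * G)
      ≤ (idxNorm (d, t) : ℝ) * (((idxNorm (d, t) : ℝ) + idxNorm (d, t)) * G) :=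
        mul_le_mul hNt (mul_le_mul_of_nonneg_right (add_le_add hN0 hN1) hG0) hG' (Nat.cast_nonneg _)
    _ = 2 * (idxNorm (d, t) : ℝ) ^ 2 * G := by ring

/-- ★ THE WEIGHTED PARALLELOGRAM SUM under a sup: `Σ_{Y ∈ V} idxWt(Y − X)·‖pgram ψ X Y‖ ≤ 108·G` for `V` inside the `r`-neighbourhood of `X = (γ, m)`
(moment `Σ idxWt·N² ≤ 54` of WD). [this file, g58] -/
theorem sum_wt_pgram_le (ψ : Cell 2 → ℤ → E3) (γ : Cell 2) (m : ℤ) {r : ℕ} (V : Finset (Cell 2 × ℤ)) (hV : ∀ Y ∈ V, idxNorm (Y - (γ, m)) ≤ r)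
    {G : ℝ} (hG0 : 0 ≤ G)
    (hG : ∀ u : Cell 2 × ℤ, idxNorm u ≤ r →
      ‖latDiff idxAxis₃ (latDiff idxAxis₁ ψ) (γ + u.1) (m + u.2)‖ ≤ G ∧ ‖latDiff idxAxis₃ (latDiff idxAxis₂ ψ) (γ + u.1) (m + u.2)‖ ≤ G) :
    ∑ Y ∈ V, idxWt (Y - (γ, m)) * ‖pgram ψ (γ, m) Y‖ ≤ 108 * G := by
  have key : ∀ Y ∈ V, idxWt (Y - (γ, m)) * ‖pgram ψ (γ, m) Y‖ ≤ 2 * G * (idxWt (Y - (γ, m)) * (idxNorm (Y - (γ, m)) : ℝ) ^ 2) := by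
    intro Y hY
    have hr := hV Y hY
    obtain ⟨⟨d, t⟩, rfl⟩ : ∃ v : Cell 2 × ℤ, Y = (γ + v.1, m + v.2) := ⟨Y - (γ, m), Prod.ext (by simp) (by simp)⟩
    dsimp only at hr ⊢
    have hv : (γ + d, m + t) - (γ, m) = (d, t) := Prod.ext (add_sub_cancel_left _ _) (add_sub_cancel_left _ _)
    rw [hv] at hr ⊢
    have h := norm_pgram_le_of_sup ψ γ d m t hr hG0 hG
    have hw := idxWt_nonneg (d, t)
    nlinarith [mul_le_mul_of_nonneg_left h hw]
  calc ∑ Y ∈ V, idxWt (Y - (γ, m)) * ‖pgram ψ (γ, m) Y‖ ≤ ∑ Y ∈ V, 2 * G * (idxWt (Y - (γ, m)) * (idxNorm (Y - (γ, m)) : ℝ) ^ 2) := sum_le_sum key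
    _ = 2 * G * ∑ Y ∈ V, idxWt (Y - (γ, m)) * (idxNorm (Y - (γ, m)) : ℝ) ^ 2 := by rw [← mul_sum]
    _ ≤ 2 * G * 54 := mul_le_mul_of_nonneg_left (sum_idxWt_mul_sq_le V (γ, m)) (by positivity)
    _ = 108 * G := by ring

/-! ### WR.2  One step of the column flux at a harmonic site -/

/-- ★ ONE STEP OF THE COLUMN FLUX at a harmonic site `(γ, m)` of `ψ`: with `G` a sup of the mixed second differences `D₃D_iψ` on the `⌊ϱ/c⌋`-neighbourhood
of `(γ, m)` and `G₂` a sup of the in-plane second differences on the `3⌊ϱ/c⌋`-box of the layer `m` about `γ`,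
`‖colFlux T ψ γ m − colFlux T ψ γ (m − 1)‖ ≤ 216·K·(G + 2G₂)` (WD `norm_colFluxDiv_le` + `sum_wt_pgram_le` + WE `sum_wt_sdiff2_le`). [this file, g58] -/
theorem norm_colFlux_step_le (hc : 0 < c) (hL : IsLayeredCrystal c a b w) {ϱ : ℝ} (ψ : Cell 2 → ℤ → E3) {T : Finset ℤ} {γ : Cell 2} {m : ℤ}
    (hm : m ∈ T) (hS : ∀ Y : Cell 2 × ℤ, ‖lsite a b w Y.1 Y.2 - lsite a b w γ m‖ ≤ ϱ → Y.2 ∈ T) (hres : truncResidual ϱ a b w ψ (γ, m) = 0)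
    {G G₂ : ℝ} (hG0 : 0 ≤ G) (hG20 : 0 ≤ G₂)
    (hG : ∀ u : Cell 2 × ℤ, idxNorm u ≤ ⌊ϱ / c⌋₊ →
      ‖latDiff idxAxis₃ (latDiff idxAxis₁ ψ) (γ + u.1) (m + u.2)‖ ≤ G ∧ ‖latDiff idxAxis₃ (latDiff idxAxis₂ ψ) (γ + u.1) (m + u.2)‖ ≤ G)
    (hG₂ : ∀ p : Cell 2, (∀ j, |p j - γ j| ≤ 3 * (⌊ϱ / c⌋₊ : ℤ)) →
      ‖latDiff idxAxis₁ (latDiff idxAxis₁ ψ) p m‖ ≤ G₂ ∧ ‖latDiff idxAxis₂ (latDiff idxAxis₁ ψ) p m‖ ≤ G₂ ∧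
      ‖latDiff idxAxis₁ (latDiff idxAxis₂ ψ) p m‖ ≤ G₂ ∧ ‖latDiff idxAxis₂ (latDiff idxAxis₂ ψ) p m‖ ≤ G₂) :
    ‖colFlux ϱ a b w T ψ γ m - colFlux ϱ a b w T ψ γ (m - 1)‖ ≤ 216 * kernelConst c * (G + 2 * G₂) := by
  have hF := kernelConst_nonneg hc
  have hdiv := norm_colFluxDiv_le hc hL ψ hm hS hres
  have hV : ∀ Y ∈ (finite_near_lsite hc hL (γ, m) ϱ).toFinset, idxNorm (Y - (γ, m)) ≤ ⌊ϱ / c⌋₊ := fun Y hY =>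
    idxNorm_le_of_near hc hL ((finite_near_lsite hc hL (γ, m) ϱ).mem_toFinset.mp hY)
  have hAP := sum_wt_pgram_le ψ γ m _ hV hG0 hG
  have hAS := sum_wt_sdiff2_le ψ γ m _ hV hG20 hG₂
  calc ‖colFlux ϱ a b w T ψ γ m - colFlux ϱ a b w T ψ γ (m - 1)‖
      ≤ 2 * kernelConst c * ∑ Y ∈ (finite_near_lsite hc hL (γ, m) ϱ).toFinset, idxWt (Y - (γ, m)) * (‖pgram ψ (γ, m) Y‖ + ‖sdiff2 ψ (γ, m) Y‖) :=
        hdiv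
    _ = 2 * kernelConst c * ((∑ Y ∈ (finite_near_lsite hc hL (γ, m) ϱ).toFinset, idxWt (Y - (γ, m)) * ‖pgram ψ (γ, m) Y‖) +
          ∑ Y ∈ (finite_near_lsite hc hL (γ, m) ϱ).toFinset, idxWt (Y - (γ, m)) * ‖sdiff2 ψ (γ, m) Y‖) := by
        rw [← sum_add_distrib]
        exact congrArg _ (sum_congr rfl fun Y _ => by ring)
    _ ≤ 2 * kernelConst c * (108 * G + 216 * G₂) := mul_le_mul_of_nonneg_left (add_le_add hAP hAS) (by positivity)
    _ = 216 * kernelConst c * (G + 2 * G₂) := by ring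

/-! ### WR.3  The step on the central column of a half ball -/

/-- a site `(p, β)` with `|p_j − γ₀_j| ≤ M` lies at index distance `≤ |β − α₀| + M` from `x₀ = (γ₀, α₀)`. [formal bookkeeping] -/
theorem dist_site_le (x₀ : Cell 2 × ℤ) {p : Cell 2} (β : ℤ) {M : ℕ} (hp : ∀ j, |p j - x₀.1 j| ≤ (M : ℤ)) :
    dist ((p, β) : Cell 2 × ℤ) x₀ ≤ |((β - x₀.2 : ℤ) : ℝ)| + (M : ℝ) := by
  have h0 := hp 0
  have h1 := hp 1
  rw [Int.abs_eq_natAbs] at h0 h1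
  have e : ((p, β) : Cell 2 × ℤ) - x₀ = (p - x₀.1, β - x₀.2) := rfl
  have hN : idxNorm (((p, β) : Cell 2 × ℤ) - x₀) ≤ (β - x₀.2).natAbs + M := by
    rw [e]
    refine idxNorm_mk_le ?_ ?_ ?_
    · have : (p - x₀.1) 0 = p 0 - x₀.1 0 := rfl
      rw [this]; omega
    · have : (p - x₀.1) 1 = p 1 - x₀.1 1 := rfl
      rw [this]; omega
    · omega
  rw [dist_comm, dist_eq_idxNorm]
  have h := (Nat.cast_le (α := ℝ)).mpr hN
  push_cast [Nat.cast_natAbs] at h ⊢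
  exact h

/-- ★ THE STEP ON THE CENTRAL COLUMN: for `φ` truncated-harmonic on `idxBall x₀ n`, `n ≥ 512(ϱ/c + 2)`, a layer `k` with `|k − α₀| + 3⌊ϱ/c⌋₊ ≤ n/2`
and a carrier `T` containing the layers within `⌊ϱ/c⌋₊` of `k`:
`‖colFlux T φ x₀.1 k − colFlux T φ x₀.1 (k − 1)‖ ≤ 216·K·(η_g + 2η_h)` with the `ϱ`-free half-ball sups `η_g` (WM `norm_gap_halfBall`) and `η_h`
(WM `norm_hessian_halfBall`). [this file, g58] -/
theorem norm_colFlux_step_halfBall (hc : 0 < c) (hL : IsLayeredCrystal c a b w) {κ₀ ε ϱ : ℝ} (hκ₀ : 0 < κ₀) (hϱ : 0 ≤ ϱ) (hε : ε < 2 * κ₀)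
    (hK : CoerciveZ (layeredKernel a b w) κ₀)
    (hT : ∀ φ : Cell 2 → ℤ → E3, HasFiniteSupport φ → Summable (tailFam ϱ a b w φ) ∧ ∑' x, tailFam ϱ a b w φ x ≤ ε * nnFormZ φ)
    (hP : ∀ E₀ : Cell 2 × ℤ, E₀.2 = 0 → (idxNorm E₀ : ℝ) ≤ 1 → ∀ (y₀ : Cell 2 × ℤ) (r' n' : ℝ), r' < n' → ∀ χ : Cell 2 → ℤ → E3,
      IsTruncHarmonicZ ϱ a b w χ (idxBall y₀ (n' + 1)) →
        κ₀ * idxEnergy (latDiff E₀ χ) (idxBall y₀ r') ≤ 54 * kernelConst c * ((n' - r')⁻¹) ^ 2 * idxEnergy χ (idxBall y₀ (n' + ϱ / c + 1)))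
    (x₀ : Cell 2 × ℤ) {n : ℝ} (hn : 512 * (ϱ / c + 2) ≤ n) {φ : Cell 2 → ℤ → E3} (hφ : IsTruncHarmonicZ ϱ a b w φ (idxBall x₀ n))
    {T : Finset ℤ} {k : ℤ} (hk : |((k - x₀.2 : ℤ) : ℝ)| + 3 * (⌊ϱ / c⌋₊ : ℝ) ≤ n / 2)
    (hTk : ∀ β : ℤ, |((β - k : ℤ) : ℝ)| ≤ ⌊ϱ / c⌋₊ → β ∈ T) :
    ‖colFlux ϱ a b w T φ x₀.1 k - colFlux ϱ a b w T φ x₀.1 (k - 1)‖ ≤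
      216 * kernelConst c * (Real.sqrt (864 * gradConst c κ₀ ε * idxEnergy φ (idxBall x₀ n) / (n ^ 2 * (idxBall x₀ n).ncard)) +
        2 * Real.sqrt (864 * (6912 * (54 * kernelConst c / κ₀) * lipConst c κ₀) * idxEnergy φ (idxBall x₀ n) / (n ^ 2 * (idxBall x₀ n).ncard))) := by
  have hϱc : 0 ≤ ϱ / c := div_nonneg hϱ hc.le
  have hr0 : (0 : ℝ) ≤ ⌊ϱ / c⌋₊ := Nat.cast_nonneg _
  have hn0 : 0 < n := by linarith
  have hn64 : 64 * (ϱ / c + 2) ≤ n := by linarith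
  have habs0 : 0 ≤ |((k - x₀.2 : ℤ) : ℝ)| := abs_nonneg _
  -- the carrier and harmonicity hypotheses of the divergence identity
  have hm : k ∈ T := hTk k (by rw [sub_self, Int.cast_zero, abs_zero]; exact hr0)
  have hS : ∀ Y : Cell 2 × ℤ, ‖lsite a b w Y.1 Y.2 - lsite a b w x₀.1 k‖ ≤ ϱ → Y.2 ∈ T := by
    intro Y hY
    have hN := idxNorm_le_of_near hc hL (X := (x₀.1, k)) hY
    have h2 := (natAbs_snd_le_idxNorm (Y - (x₀.1, k))).trans hN
    have e2 : (Y - (x₀.1, k)).2 = Y.2 - k := rfl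
    rw [e2] at h2
    refine hTk Y.2 ?_
    have h3 := (Nat.cast_le (α := ℝ)).mpr h2
    rw [Nat.cast_natAbs, Int.cast_abs] at h3
    exact h3
  have hcol' : dist ((x₀.1, k) : Cell 2 × ℤ) x₀ ≤ |((k - x₀.2 : ℤ) : ℝ)| := by
    have h := dist_site_le x₀ k (M := 0) (p := x₀.1) fun j => by simp
    rw [Nat.cast_zero, add_zero] at h
    exact h
  have hcol : ((x₀.1, k) : Cell 2 × ℤ) ∈ idxBall x₀ n := by
    show dist ((x₀.1, k) : Cell 2 × ℤ) x₀ ≤ n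
    linarith
  have hres : truncResidual ϱ a b w φ (x₀.1, k) = 0 := truncResidual_eq_zero_of_isTruncHarmonicZ hφ hcol
  -- the two half-ball sups
  have hG : ∀ u : Cell 2 × ℤ, idxNorm u ≤ ⌊ϱ / c⌋₊ →
      ‖latDiff idxAxis₃ (latDiff idxAxis₁ φ) (x₀.1 + u.1) (k + u.2)‖ ≤
          Real.sqrt (864 * gradConst c κ₀ ε * idxEnergy φ (idxBall x₀ n) / (n ^ 2 * (idxBall x₀ n).ncard)) ∧
        ‖latDiff idxAxis₃ (latDiff idxAxis₂ φ) (x₀.1 + u.1) (k + u.2)‖ ≤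
          Real.sqrt (864 * gradConst c κ₀ ε * idxEnergy φ (idxBall x₀ n) / (n ^ 2 * (idxBall x₀ n).ncard)) := by
    intro u hu
    have hur : (idxNorm u : ℝ) ≤ ⌊ϱ / c⌋₊ := by exact_mod_cast hu
    have hZ : ((x₀.1 + u.1, k + u.2) : Cell 2 × ℤ) ∈ idxBall x₀ (n / 2) := by
      show dist ((x₀.1 + u.1, k + u.2) : Cell 2 × ℤ) x₀ ≤ n / 2
      have h1 : dist ((x₀.1 + u.1, k + u.2) : Cell 2 × ℤ) (x₀.1, k) = (idxNorm u : ℝ) := by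
        rw [dist_comm, dist_eq_idxNorm,
          show ((x₀.1 + u.1, k + u.2) : Cell 2 × ℤ) - (x₀.1, k) = u from Prod.ext (add_sub_cancel_left _ _) (add_sub_cancel_left _ _)]
      have h2 := dist_triangle ((x₀.1 + u.1, k + u.2) : Cell 2 × ℤ) (x₀.1, k) x₀
      linarith
    have h1 := norm_gap_halfBall hc hL hκ₀ hϱ hε hK hT hP x₀ hn hφ idxAxis₁_snd idxNorm_idxAxis₁_le hZ
    have h2 := norm_gap_halfBall hc hL hκ₀ hϱ hε hK hT hP x₀ hn hφ idxAxis₂_snd idxNorm_idxAxis₂_le hZ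
    exact ⟨h1, h2⟩
  have hG₂ : ∀ p : Cell 2, (∀ j, |p j - x₀.1 j| ≤ 3 * (⌊ϱ / c⌋₊ : ℤ)) →
      ‖latDiff idxAxis₁ (latDiff idxAxis₁ φ) p k‖ ≤
          Real.sqrt (864 * (6912 * (54 * kernelConst c / κ₀) * lipConst c κ₀) * idxEnergy φ (idxBall x₀ n) / (n ^ 2 * (idxBall x₀ n).ncard)) ∧
        ‖latDiff idxAxis₂ (latDiff idxAxis₁ φ) p k‖ ≤
          Real.sqrt (864 * (6912 * (54 * kernelConst c / κ₀) * lipConst c κ₀) * idxEnergy φ (idxBall x₀ n) / (n ^ 2 * (idxBall x₀ n).ncard)) ∧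
        ‖latDiff idxAxis₁ (latDiff idxAxis₂ φ) p k‖ ≤
          Real.sqrt (864 * (6912 * (54 * kernelConst c / κ₀) * lipConst c κ₀) * idxEnergy φ (idxBall x₀ n) / (n ^ 2 * (idxBall x₀ n).ncard)) ∧
        ‖latDiff idxAxis₂ (latDiff idxAxis₂ φ) p k‖ ≤
          Real.sqrt (864 * (6912 * (54 * kernelConst c / κ₀) * lipConst c κ₀) * idxEnergy φ (idxBall x₀ n) / (n ^ 2 * (idxBall x₀ n).ncard)) := by
    intro p hp
    have hp' : ∀ j, |p j - x₀.1 j| ≤ ((3 * ⌊ϱ / c⌋₊ : ℕ) : ℤ) := fun j => by push_cast; exact hp j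
    have hZ : ((p, k) : Cell 2 × ℤ) ∈ idxBall x₀ (n / 2) := by
      show dist ((p, k) : Cell 2 × ℤ) x₀ ≤ n / 2
      have h := dist_site_le x₀ k hp'
      rw [Nat.cast_mul, Nat.cast_ofNat] at h
      linarith
    have h11 := norm_hessian_halfBall hc hκ₀ hϱ hP x₀ hn64 hφ idxAxis₁_snd idxNorm_idxAxis₁_le idxAxis₁_snd idxNorm_idxAxis₁_le hZ
    have h21 := norm_hessian_halfBall hc hκ₀ hϱ hP x₀ hn64 hφ idxAxis₂_snd idxNorm_idxAxis₂_le idxAxis₁_snd idxNorm_idxAxis₁_le hZ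
    have h12 := norm_hessian_halfBall hc hκ₀ hϱ hP x₀ hn64 hφ idxAxis₁_snd idxNorm_idxAxis₁_le idxAxis₂_snd idxNorm_idxAxis₂_le hZ
    have h22 := norm_hessian_halfBall hc hκ₀ hϱ hP x₀ hn64 hφ idxAxis₂_snd idxNorm_idxAxis₂_le idxAxis₂_snd idxNorm_idxAxis₂_le hZ
    exact ⟨h11, h21, h12, h22⟩
  exact norm_colFlux_step_le hc hL φ hm hS hres (Real.sqrt_nonneg _) (Real.sqrt_nonneg _) hG hG₂

/-! ### WR.4  The flux drift along the central column -/

/-- ★★ THE FLUX DRIFT, ϱ-FREE: for `φ` truncated-harmonic on `idxBall x₀ n`, `n ≥ 512(ϱ/c + 2)`, a layer `m` with `|m − α₀| + 3⌊ϱ/c⌋₊ ≤ n/2` and a carrier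
`T` containing every layer within `|m − α₀| + ⌊ϱ/c⌋₊` of `α₀`, the column flux along the central column drifts at most linearly:
`‖colFlux T φ x₀.1 m − colFlux T φ x₀.1 x₀.2‖ ≤ 216·K·(η_g + 2η_h)·|m − α₀|` (`norm_colFlux_step_halfBall` telescoped, WL `norm_sub_le_of_steps`);
`η_g`, `η_h` as in `norm_colFlux_step_halfBall`, every constant `ϱ`-free. [this file, g58] -/
theorem norm_colFlux_drift_le (hc : 0 < c) (hL : IsLayeredCrystal c a b w) {κ₀ ε ϱ : ℝ} (hκ₀ : 0 < κ₀) (hϱ : 0 ≤ ϱ) (hε : ε < 2 * κ₀)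
    (hK : CoerciveZ (layeredKernel a b w) κ₀)
    (hT : ∀ φ : Cell 2 → ℤ → E3, HasFiniteSupport φ → Summable (tailFam ϱ a b w φ) ∧ ∑' x, tailFam ϱ a b w φ x ≤ ε * nnFormZ φ)
    (hP : ∀ E₀ : Cell 2 × ℤ, E₀.2 = 0 → (idxNorm E₀ : ℝ) ≤ 1 → ∀ (y₀ : Cell 2 × ℤ) (r' n' : ℝ), r' < n' → ∀ χ : Cell 2 → ℤ → E3,
      IsTruncHarmonicZ ϱ a b w χ (idxBall y₀ (n' + 1)) →
        κ₀ * idxEnergy (latDiff E₀ χ) (idxBall y₀ r') ≤ 54 * kernelConst c * ((n' - r')⁻¹) ^ 2 * idxEnergy χ (idxBall y₀ (n' + ϱ / c + 1)))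
    (x₀ : Cell 2 × ℤ) {n : ℝ} (hn : 512 * (ϱ / c + 2) ≤ n) {φ : Cell 2 → ℤ → E3} (hφ : IsTruncHarmonicZ ϱ a b w φ (idxBall x₀ n))
    {T : Finset ℤ} {m : ℤ} (hm : |((m - x₀.2 : ℤ) : ℝ)| + 3 * (⌊ϱ / c⌋₊ : ℝ) ≤ n / 2)
    (hTm : ∀ β : ℤ, |((β - x₀.2 : ℤ) : ℝ)| ≤ |((m - x₀.2 : ℤ) : ℝ)| + ⌊ϱ / c⌋₊ → β ∈ T) :
    ‖colFlux ϱ a b w T φ x₀.1 m - colFlux ϱ a b w T φ x₀.1 x₀.2‖ ≤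
      216 * kernelConst c * (Real.sqrt (864 * gradConst c κ₀ ε * idxEnergy φ (idxBall x₀ n) / (n ^ 2 * (idxBall x₀ n).ncard)) +
        2 * Real.sqrt (864 * (6912 * (54 * kernelConst c / κ₀) * lipConst c κ₀) * idxEnergy φ (idxBall x₀ n) / (n ^ 2 * (idxBall x₀ n).ncard))) *
        |((m - x₀.2 : ℤ) : ℝ)| := by
  set δ := 216 * kernelConst c * (Real.sqrt (864 * gradConst c κ₀ ε * idxEnergy φ (idxBall x₀ n) / (n ^ 2 * (idxBall x₀ n).ncard)) +
    2 * Real.sqrt (864 * (6912 * (54 * kernelConst c / κ₀) * lipConst c κ₀) * idxEnergy φ (idxBall x₀ n) / (n ^ 2 * (idxBall x₀ n).ncard)))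
    with hδ
  -- every step between `α₀` and `m`
  have hstep : ∀ k : ℤ, |((k - x₀.2 : ℤ) : ℝ)| ≤ |((m - x₀.2 : ℤ) : ℝ)| →
      ‖colFlux ϱ a b w T φ x₀.1 k - colFlux ϱ a b w T φ x₀.1 (k - 1)‖ ≤ δ := by
    intro k hk
    refine norm_colFlux_step_halfBall hc hL hκ₀ hϱ hε hK hT hP x₀ hn hφ (by linarith) fun β hβ => hTm β ?_
    have htri : |((β - x₀.2 : ℤ) : ℝ)| ≤ |((β - k : ℤ) : ℝ)| + |((k - x₀.2 : ℤ) : ℝ)| := by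
      push_cast
      exact abs_sub_le _ _ _
    linarith
  rcases le_total x₀.2 m with hle | hle
  · -- `α₀ ≤ m`: walk up from `α₀`
    obtain ⟨N, hN⟩ : ∃ N : ℕ, m = x₀.2 + N := ⟨(m - x₀.2).toNat, by omega⟩
    have habs : |((m - x₀.2 : ℤ) : ℝ)| = N := by
      rw [hN]; push_cast; rw [show (x₀.2 : ℝ) + (N : ℝ) - x₀.2 = N by ring]; exact abs_of_nonneg (Nat.cast_nonneg N)
    have hu := norm_sub_le_of_steps (fun i : ℕ => colFlux ϱ a b w T φ x₀.1 (x₀.2 + (i : ℤ))) (N := N) (δ := δ) (fun i hi => by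
      show ‖colFlux ϱ a b w T φ x₀.1 (x₀.2 + ((i + 1 : ℕ) : ℤ)) - colFlux ϱ a b w T φ x₀.1 (x₀.2 + ((i : ℕ) : ℤ))‖ ≤ δ
      have e : x₀.2 + ((i : ℕ) : ℤ) = x₀.2 + ((i + 1 : ℕ) : ℤ) - 1 := by push_cast; ring
      rw [e]
      refine hstep _ ?_
      have e2 : (((x₀.2 + ((i + 1 : ℕ) : ℤ) - x₀.2 : ℤ)) : ℝ) = (i : ℝ) + 1 := by push_cast; ring
      have hi' : (i : ℝ) + 1 ≤ N := by exact_mod_cast hi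
      rw [e2, habs, abs_of_nonneg (by positivity : (0 : ℝ) ≤ (i : ℝ) + 1)]
      exact hi') le_rfl (Nat.zero_le N)
    rw [habs, hN, mul_comm δ]
    simpa using hu
  · -- `m ≤ α₀`: walk up from `m`
    obtain ⟨N, hN⟩ : ∃ N : ℕ, m = x₀.2 - N := ⟨(x₀.2 - m).toNat, by omega⟩
    have habs : |((m - x₀.2 : ℤ) : ℝ)| = N := by
      rw [hN]; push_cast; rw [show (x₀.2 : ℝ) - (N : ℝ) - x₀.2 = -(N : ℝ) by ring, abs_neg]; exact abs_of_nonneg (Nat.cast_nonneg N)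
    have hu := norm_sub_le_of_steps (fun i : ℕ => colFlux ϱ a b w T φ x₀.1 (m + (i : ℤ))) (N := N) (δ := δ) (fun i hi => by
      show ‖colFlux ϱ a b w T φ x₀.1 (m + ((i + 1 : ℕ) : ℤ)) - colFlux ϱ a b w T φ x₀.1 (m + ((i : ℕ) : ℤ))‖ ≤ δ
      have e : m + ((i : ℕ) : ℤ) = m + ((i + 1 : ℕ) : ℤ) - 1 := by push_cast; ring
      rw [e]
      refine hstep _ ?_
      have e2 : (((m + ((i + 1 : ℕ) : ℤ) - x₀.2 : ℤ)) : ℝ) = (i : ℝ) + 1 - N := by rw [hN]; push_cast; ring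
      have hi' : (i : ℝ) + 1 ≤ N := by exact_mod_cast hi
      have hi0 : (0 : ℝ) ≤ i := Nat.cast_nonneg i
      rw [e2, habs, abs_le]
      constructor <;> linarith) (Nat.zero_le N) le_rfl
    have e3 : x₀.2 = m + (N : ℤ) := by omega
    rw [habs, e3, mul_comm δ]
    simpa using hu

/-! ### WR.5  The closed statement of this part -/

/-- The content of part WR as one closed proposition: the one-step column flux bound under sups and the ϱ-free flux drift along the central column of
a half ball. -/
def FluxDriftShape : Prop :=
  ∀ c : ℝ, 0 < c → ∀ (a b : E3) (w : ℤ → E3), IsLayeredCrystal c a b w → ∀ (ϱ : ℝ),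
    (∀ (ψ : Cell 2 → ℤ → E3) (T : Finset ℤ) (γ : Cell 2) (m : ℤ), m ∈ T →
      (∀ Y : Cell 2 × ℤ, ‖lsite a b w Y.1 Y.2 - lsite a b w γ m‖ ≤ ϱ → Y.2 ∈ T) → truncResidual ϱ a b w ψ (γ, m) = 0 →
      ∀ G G₂ : ℝ, 0 ≤ G → 0 ≤ G₂ →
        (∀ u : Cell 2 × ℤ, idxNorm u ≤ ⌊ϱ / c⌋₊ →
          ‖latDiff idxAxis₃ (latDiff idxAxis₁ ψ) (γ + u.1) (m + u.2)‖ ≤ G ∧ ‖latDiff idxAxis₃ (latDiff idxAxis₂ ψ) (γ + u.1) (m + u.2)‖ ≤ G) →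
        (∀ p : Cell 2, (∀ j, |p j - γ j| ≤ 3 * (⌊ϱ / c⌋₊ : ℤ)) →
          ‖latDiff idxAxis₁ (latDiff idxAxis₁ ψ) p m‖ ≤ G₂ ∧ ‖latDiff idxAxis₂ (latDiff idxAxis₁ ψ) p m‖ ≤ G₂ ∧
          ‖latDiff idxAxis₁ (latDiff idxAxis₂ ψ) p m‖ ≤ G₂ ∧ ‖latDiff idxAxis₂ (latDiff idxAxis₂ ψ) p m‖ ≤ G₂) →
        ‖colFlux ϱ a b w T ψ γ m - colFlux ϱ a b w T ψ γ (m - 1)‖ ≤ 216 * kernelConst c * (G + 2 * G₂)) ∧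
    ∀ κ₀ ε : ℝ, 0 < κ₀ → 0 ≤ ϱ → ε < 2 * κ₀ → CoerciveZ (layeredKernel a b w) κ₀ →
      (∀ φ : Cell 2 → ℤ → E3, HasFiniteSupport φ → Summable (tailFam ϱ a b w φ) ∧ ∑' x, tailFam ϱ a b w φ x ≤ ε * nnFormZ φ) →
      (∀ E₀ : Cell 2 × ℤ, E₀.2 = 0 → (idxNorm E₀ : ℝ) ≤ 1 → ∀ (y₀ : Cell 2 × ℤ) (r' n' : ℝ), r' < n' → ∀ χ : Cell 2 → ℤ → E3,
        IsTruncHarmonicZ ϱ a b w χ (idxBall y₀ (n' + 1)) →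
          κ₀ * idxEnergy (latDiff E₀ χ) (idxBall y₀ r') ≤ 54 * kernelConst c * ((n' - r')⁻¹) ^ 2 * idxEnergy χ (idxBall y₀ (n' + ϱ / c + 1))) →
      ∀ (x₀ : Cell 2 × ℤ) (n : ℝ), 512 * (ϱ / c + 2) ≤ n → ∀ φ : Cell 2 → ℤ → E3, IsTruncHarmonicZ ϱ a b w φ (idxBall x₀ n) →
        ∀ (T : Finset ℤ) (m : ℤ), |((m - x₀.2 : ℤ) : ℝ)| + 3 * (⌊ϱ / c⌋₊ : ℝ) ≤ n / 2 →
          (∀ β : ℤ, |((β - x₀.2 : ℤ) : ℝ)| ≤ |((m - x₀.2 : ℤ) : ℝ)| + ⌊ϱ / c⌋₊ → β ∈ T) →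
          ‖colFlux ϱ a b w T φ x₀.1 m - colFlux ϱ a b w T φ x₀.1 x₀.2‖ ≤
            216 * kernelConst c * (Real.sqrt (864 * gradConst c κ₀ ε * idxEnergy φ (idxBall x₀ n) / (n ^ 2 * (idxBall x₀ n).ncard)) +
              2 * Real.sqrt (864 * (6912 * (54 * kernelConst c / κ₀) * lipConst c κ₀) * idxEnergy φ (idxBall x₀ n) /
                (n ^ 2 * (idxBall x₀ n).ncard))) * |((m - x₀.2 : ℤ) : ℝ)|

/-- WR holds. [this file, g58] -/
theorem fluxDriftShape_holds : FluxDriftShape :=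
  fun _c hc _a _b _w hL _ϱ => ⟨fun ψ _T _γ _m hm hS hres _G _G₂ hG0 hG20 hG hG₂ => norm_colFlux_step_le hc hL ψ hm hS hres hG0 hG20 hG hG₂,
    fun _κ₀ _ε hκ₀ hϱ hε hK hT hP x₀ _n hn _φ hφ _T _m hm hTm => norm_colFlux_drift_le hc hL hκ₀ hϱ hε hK hT hP x₀ hn hφ hm hTm⟩

end FluxDrift

end Summit.AtomisticToContinuum.Crystallization.Theorems.ChartedZeroExcessLayeredLatticeLiouville
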